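import Summits.BirchSwinnertonDyer.Rank1Residual.X11b.AnticyclotomicLogLinks
import Summits.BirchSwinnertonDyer.Rank1Residual.X11b.RouteR1NonVacuity
import HarnessLib

/-!
# X11b, route R1 — non-vacuity of the tree-object inputs: at every pair of the population the
# open input is exercised on an ACTUAL anticyclotomic tower, prime and embedding

HONEST FRAMING (cell `b2b-bsdres`, run/shared/lean/b2b/bsd-rank1-residual/, verbatim in every
file): the goal of the cell is to DELETE the COMBINATION-SHAPED residual classes of the
Birch–Swinnerton-Dyer formula for ALL analytic-rank `≤ 1` elliptic curves over `ℚ` — "full BSD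
formula for every rank `≤ 1` curve in class `C`" assembled STRICTLY from published theorems — so
that the rank-`≤ 1` remainder becomes exactly the CONSTRUCTION-SHAPED classes, which are TYPED
(missing-input `Prop`s), NOT attempted. This is not "finishing BSD". Sub-cell
`b2b-bsdres-multr1-p1` (X11b, route R1); a RESEARCH ROUTE; no claim beyond the stated class; X11b
stays CONSTRUCTION-SHAPED; nothing here changes a label. THEOREMS ONLY (no definition, no named
fact, no `sorry`).

## Content

The gen-8 statement of record `R1.bsdp_of_onTree` (`AnticyclotomicLogLinks`) consumes two typed
inputs quantified over data `(q, K, Dt, H, ι, P)` and `(κ, γ, 𝔭)`: the PUB-shaped `R1ControlOnTreeAt`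
(Cas18 Thm. 2.3 on the constructed `X_ac`, the tree's formal logarithm and `∏_{w∣N⁺} c_w`) and the
OPEN `R1OpenInputOnTreeAt` ((IMC)∘(BDP) at `𝟙`). As gen 7 did for `R1OpenInputAt` (lit g14's vacuity
check on gen 1's form), this file proves that the quantifier domain is INHABITED at every pair of
the population, so the hypotheses are used at realised instances:

* `R1.exists_onTree_antecedents` — for every `(W, p)` on `R1Population` with `r_an = 1`, granted the
  published facts of `R1.exists_antecedents` (modularity, Cai–Shu–Tian, Friedberg–Hoffstein, Mazur,
  Néron): there are `q, K, Dt, H, ι, P` meeting every antecedent AND an anticyclotomic `ℤ_p`-extension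
  `κ` of `K` (tree: global reciprocity), a topological generator `γ`, and a prime `𝔭 ∋ p` of `𝓞_K`
  of DEGREE ONE (`p ∣ N_E` splits in the erratum field).
* `R1.exists_hasCharValuationAt_of_onTree` — granted the two typed inputs, every such pair carries an
  ACTUAL anticyclotomic tower, generator, degree-one prime, the embedding `embAt K p 𝔭`, a point
  `P ∈ E(K)` of infinite order and an `n` with `XAc.HasCharValuationAt (E_K) p κ 𝔭 ∅ γ n` (the
  CONSTRUCTED `X_ac(E[p^∞])` is `Λ`-torsion with a principal characteristic ideal whose generator has
  `ord_p f(0) = n = 2·(ord_p log_ω P − 1)`), together with Castella's (5.2) and (5.3) at that datum.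

References: [Castella2018] §5 (arXiv:1704.06608 p. 12); [Castella2018Erratum] Thm. 1.1 (p. 1);
[GreenbergLNM1716] §1 (anticyclotomic `ℤ_p`-extension).
-/

noncomputable section

open scoped Classical

open WeierstrassCurve NumberField IsDedekindDomain Literature.NumberTheory.EllipticCurves
  Literature.NumberTheory.EllipticCurves.ModularForms
  Literature.NumberTheory.EllipticCurves.Rank1Residual
  Literature.NumberTheory.EllipticCurves.Rank1Residual.Typed
  Summit.BirchSwinnertonDyer.Rank1Residual.X11b.AcSelmer

namespace Summit.BirchSwinnertonDyer.Rank1Residual.X11b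

/-- **All antecedents of the tree-object inputs are realised at every population pair.** For
`(W, p)` on `R1Population` with `ord_{s=1}L(E,s) = 1`, granted the PUBLISHED named facts `hmod`,
`hCST`, `hFH`, `hMaz`, `hNS` (as in `R1.exists_antecedents`): there are `q`, an erratum field `K`,
`Dt`, `H`, `ι`, `P` meeting every antecedent of `R1OpenInputOnTreeAt W p` / `R1ControlOnTreeAt W p`,
together with an ANTICYCLOTOMIC `ℤ_p`-extension `κ` of `K`, a topological generator `γ`, and a prime
`𝔭 ∋ p` of `𝓞_K` with `e(𝔭|p) = f(𝔭|p) = 1`. [cite: Castella2018, §5 (arXiv:1704.06608 p. 12), choice of K and P_K]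
[cite: GreenbergLNM1716, §1 (the anticyclotomic ℤ_p-extension)] -/
theorem R1.exists_onTree_antecedents
    (hmod : exists_isNewformOf) (hCST : CaiShuTian2014.thm11_trivialChar)
    (hFH : friedbergHoffstein_exists_twist_ne_zero_ramifiedAt)
    (hMaz : mazur_not_dvd_maninConstant_of_odd) (hNS : integral_neronScaling_of_isGloballyMinimal)
    (W : WeierstrassCurve ℚ) [W.IsElliptic] [W.IsGloballyMinimal] (p : ℕ) [Fact p.Prime]
    (hW : R1Population W p) (hr : W.analyticRank = 1) :
    ∃ (q : ℕ) (_ : Fact q.Prime) (K : Type) (_ : Field K) (_ : NumberField K)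
      (_ : NeZero (W.conductorNorm ℤ))
      (Dt : ModularParametrizationData W (W.conductorNorm ℤ))
      (H : HeegnerDatum (W.conductorNorm ℤ) (NumberField.discr K)) (ι : K →+* ℂ)
      (P : (W.baseChange K).toAffine.Point) (κ : ZpExtension K p) (γ : Field.absoluteGaloisGroup K)
      (𝔭 : HeightOneSpectrum (𝓞 K)),
      (ErratumHypotheses W p ∧ q ≠ p ∧ Mult W q ∧ ¬ W.HasSplitMultiplicativeReductionAtPrime q ∧
        ¬ p ∣ padicValInt q W.minimalDiscriminantInt ∧ IsErratumField W K q ∧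
        Cas20Standing K p (W.conductorNorm ℤ / p) ∧
        WeierstrassCurve.Affine.Point.map ι.toRatAlgHom P = heegnerPointComplex Dt H ∧
        ¬ (p : ℤ) ∣ Dt.c ∧ ¬ IsOfFinAddOrder P) ∧
      κ.IsAnticyclotomic ∧ κ.IsTopGenerator γ ∧ ((p : ℕ) : 𝓞 K) ∈ 𝔭.asIdeal ∧
        𝔭.asIdeal.ramificationIdx (𝓞 ℚ) = 1 ∧ 𝔭.asIdeal.inertiaDeg (𝓞 ℚ) = 1 := by
  obtain ⟨q, hqF, K, hFK, hNK, hNe, Dt, H, ι, P, hE, hqp, hmq, hnsq, hvq, hKf, hVoR, hP, hc, hnt⟩ :=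
    R1.exists_antecedents hmod hCST hFH hMaz hNS W p hW hr
  have hpN : p ∣ W.conductorNorm ℤ := dvd_conductorNorm_of_mult hE.2.1
  have hsplit : SplitsIn K p := hKf.2.2.1 p (Fact.out : p.Prime) hpN (Ne.symm hqp)
  obtain ⟨κ, γ, 𝔭, hκ, hγ, h𝔭⟩ := exists_anticyclotomic_generator_prime (p := p) hKf.1
  obtain ⟨he, hf⟩ := degreeOne_of_splitsIn hKf.1.1 hsplit h𝔭
  exact ⟨q, hqF, K, hFK, hNK, hNe, Dt, H, ι, P, κ, γ, 𝔭,
    ⟨hE, hqp, hmq, hnsq, hvq, hKf, hVoR, hP, hc, hnt⟩, hκ, hγ, h𝔭, he, hf⟩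

/-- **The tree-object inputs are exercised, not vacuous.** Granted `R1OpenInputOnTreeAt W p`,
`R1ControlOnTreeAt W p` and the published facts of `R1.exists_antecedents`, every pair of the
population with `ord_{s=1}L(E,s) = 1` carries an ACTUAL instance: a number field `K`, an
anticyclotomic `ℤ_p`-extension `κ` with generator `γ`, a degree-one prime `𝔭 ∋ p`, a point
`P ∈ E(K)` of infinite order, and `n` with `XAc.HasCharValuationAt (E_K) p κ 𝔭 ∅ γ n` — the
CONSTRUCTED `Λ`-module `X_ac(E[p^∞])` is torsion with a principal characteristic ideal, generator
`f` with `f(0) ≠ 0` and `ord_p f(0) = n = 2·(ord_p log_{ω_E} P − 1)` (the log through THE embedding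
`embAt K p 𝔭`) — and Castella's (5.2) and (5.3) hold at `(E, p, K, P)`.
[cite: Castella2018, §5 (5.1)–(5.3) (arXiv:1704.06608 p. 12)] [cite: Castella2018Erratum, Thm. 1.1 (p. 1)] -/
theorem R1.exists_hasCharValuationAt_of_onTree
    (hmod : exists_isNewformOf) (hCST : CaiShuTian2014.thm11_trivialChar)
    (hFH : friedbergHoffstein_exists_twist_ne_zero_ramifiedAt)
    (hMaz : mazur_not_dvd_maninConstant_of_odd) (hNS : integral_neronScaling_of_isGloballyMinimal)
    (W : WeierstrassCurve ℚ) [W.IsElliptic] [W.IsGloballyMinimal] (p : ℕ) [Fact p.Prime]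
    (hA : R1OpenInputOnTreeAt W p) (hC : R1ControlOnTreeAt W p)
    (hW : R1Population W p) (hr : W.analyticRank = 1) :
    ∃ (K : Type) (_ : Field K) (_ : NumberField K) (κ : ZpExtension K p)
      (γ : Field.absoluteGaloisGroup K) (hγ : κ.IsTopGenerator γ) (𝔭 : HeightOneSpectrum (𝓞 K))
      (h𝔭 : ((p : ℕ) : 𝓞 K) ∈ 𝔭.asIdeal) (he : 𝔭.asIdeal.ramificationIdx (𝓞 ℚ) = 1)
      (hf : 𝔭.asIdeal.inertiaDeg (𝓞 ℚ) = 1) (P : (W.baseChange K).toAffine.Point) (n : ℕ),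
      κ.IsAnticyclotomic ∧ ¬ IsOfFinAddOrder P ∧
      (letI : Fact (κ.IsTopGenerator γ) := ⟨hγ⟩
       XAc.HasCharValuationAt (W.baseChange K) p κ 𝔭 ∅ γ n ∧
         (n : ℤ) = 2 * (padicLogOrd W p (embAt K p 𝔭 h𝔭 he hf) P - 1)) ∧
      Display52At W p K P ∧ Display53At W p K P := by
  obtain ⟨q, hqF, K, hFK, hNK, hNe, Dt, H, ι, P, κ, γ, 𝔭,
      ⟨hE, hqp, hmq, hnsq, hvq, hKf, hVoR, hP, hc, hnt⟩, hκ, hγ, h𝔭, he, hf⟩ :=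
    R1.exists_onTree_antecedents hmod hCST hFH hMaz hNS W p hW hr
  haveI : Fact (κ.IsTopGenerator γ) := ⟨hγ⟩
  have hIW := hA q K Dt H ι P hE hr hqp hmq hnsq hvq hKf hVoR hP hc hnt κ hκ γ 𝔭 h𝔭 he hf
  have hCTL := hC q K Dt H ι P hE hr hqp hmq hnsq hvq hKf hVoR hP hc hnt κ hκ γ 𝔭 h𝔭 he hf
  have h52 : Display52At W p K P := display52At_of_onTreeLinks hIW hCTL
  have h53 : Display53At W p K P := display53At_of_onTreeLinks hE.1 hmq hvq hKf hIW hCTL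
  obtain ⟨n, hn, hne⟩ := hIW
  exact ⟨K, hFK, hNK, κ, γ, hγ, 𝔭, h𝔭, he, hf, P, n, hκ, hnt, ⟨hn, hne⟩, h52, h53⟩

end Summit.BirchSwinnertonDyer.Rank1Residual.X11b

end
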